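import Literature.AlgebraicGeometry.Resolution.ProperModels
import Literature.AlgebraicGeometry.Resolution.ProjectiveModelsFunctionField
import HarnessLib

/-!
# The function field of a proper model: `K(M) ≅ K` over `k`, and its functoriality

Topic: `Literature/AlgebraicGeometry/Resolution`. The PROPER-model twin of
`ProjectiveModelsFunctionField.lean` (Zariski–Samuel II, Ch. VI §17: the complete models of a
field `K/k` share the function field `K`). For a proper model `M` of `K/k` (`ProperModel k K`,
`ProperModels.lean`: an integral proper `k`-scheme with a `K`-point `gen_M : Spec K → M` hitting
the generic point with `𝒪_{M,ξ} ≅ K`) this file identifies Mathlib's function field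
`M.X.functionField = 𝒪_{M,ξ}`, the morphism `Spec K(M) → M` (`Scheme.fromSpecStalk`), a
`k`-algebra structure on `K(M)` and the field maps `φ^♯ : K(M) → K(N)` of morphisms of models
(`Motives.RatFn.functionFieldMap`) with the abstract `K`, verbatim as in the projective case.
All PROVED:

* `ProperModel.funFieldIso M : M.X.functionField ≅ K` with
  `specMap_funFieldIso_hom_fromSpecStalk` (`Spec K ≅ Spec K(M) → M` is `gen_M`) and
  `fromSpecStalk_genericPoint_eq`;
* the `k`-algebra structure `ProperModel.algebraFunctionField` on `K(M)` transported from `K`,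
  for which `funFieldIso` is a `k`-algebra isomorphism (`funFieldAlgEquiv`) and
  `fromSpecStalk_genericPoint_π` holds (`Spec K(M) → M → Spec k` is `Spec` of the structure map —
  the hypothesis `hgen` of `fromSpecStalk_genericPoint_toProjOfVec`);
* `ProperModel.Hom.isDominant`, `functionFieldMap_comp_funFieldIso`,
  `funFieldIso_hom_functionFieldMap`, `functionFieldMap_funFieldIso_inv`,
  `functionFieldMap_algebraMap`, `Hom.functionFieldAlgHom` — for a morphism of proper models
  `φ : N → M`, `φ^♯ : K(M) → K(N)` is THE identity of `K` under the identifications, hence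
  `k`-linear.

Used by `ProjectiveBirationalBlowupProofs.lean` (Liu 2002, Thm. 8.1.24: a blowing up of a
projective model is a priori only a PROPER model of the same field).

## References

* O. Zariski, P. Samuel, *Commutative Algebra* II, Ch. VI §17. [ZariskiSamuel1960]
* O. Piltant, RACSAM 107 (2013), §2 (proper models). [Piltant2013]
-/

noncomputable section

open CategoryTheory AlgebraicGeometry TopologicalSpace IsLocalRing
open Literature.AlgebraicGeometry.Motives

namespace Literature.AlgebraicGeometry.Resolution

universe u

namespace ProperModel

variable {k K : Type u} [Field k] [Field K] [Algebra k K]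

/-! ## `K(M) ≅ K` -/

/-- **The function field of a proper model is `K`**: the isomorphism
`K(M) = 𝒪_{M,ξ} ≅ 𝒪_{M, gen_M(pt)} ≅ K` (the second map is the stalk map of the `K`-point
`gen_M`, an isomorphism by definition of a model). [cite: ZariskiSamuel1960, Ch. VI §17] -/
def funFieldIso (M : ProperModel k K) : M.X.functionField ≅ CommRingCat.of K :=
  M.X.presheaf.stalkCongr (Inseparable.of_eq M.genericPt_eq.symm) ≪≫
    asIso (Scheme.stalkClosedPointTo M.gen)

/-- **`Spec K ≅ Spec K(M) → M` is the `K`-point `gen_M`.** [cite: ZariskiSamuel1960, Ch. VI §17] -/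
@[reassoc (attr := simp)]
theorem specMap_funFieldIso_hom_fromSpecStalk (M : ProperModel k K) :
    Spec.map M.funFieldIso.hom ≫ M.X.fromSpecStalk (genericPoint M.X) = M.gen := by
  rw [funFieldIso, Iso.trans_hom, Spec.map_comp, Category.assoc, TopCat.Presheaf.stalkCongr_hom,
    Scheme.SpecMap_stalkSpecializes_fromSpecStalk, asIso_hom,
    Scheme.Spec_stalkClosedPointTo_fromSpecStalk]

/-- `Spec K(M) → M` is `Spec K(M) ≅ Spec K → M` (`gen_M`). [folklore] -/
theorem fromSpecStalk_genericPoint_eq (M : ProperModel k K) :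
    M.X.fromSpecStalk (genericPoint M.X) = Spec.map M.funFieldIso.inv ≫ M.gen := by
  rw [← specMap_funFieldIso_hom_fromSpecStalk, ← Spec.map_comp_assoc, Iso.hom_inv_id,
    Spec.map_id, Category.id_comp]

/-- **The `k`-algebra structure on `K(M)`** transported from `K` along `K(M) ≅ K`. [folklore] -/
instance algebraFunctionField (M : ProperModel k K) : Algebra k M.X.functionField :=
  (M.funFieldIso.inv.hom.comp (algebraMap k K)).toAlgebra

/-- Unfolding the `k`-algebra structure on `K(M)`. [folklore] -/
theorem algebraMap_functionField (M : ProperModel k K) :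
    algebraMap k M.X.functionField = M.funFieldIso.inv.hom.comp (algebraMap k K) := rfl

/-- `K ≅ K(M)` maps `algebraMap k K c` to `algebraMap k K(M) c`. [folklore] -/
@[simp] theorem funFieldIso_inv_algebraMap (M : ProperModel k K) (c : k) :
    M.funFieldIso.inv.hom (algebraMap k K c) = algebraMap k M.X.functionField c := rfl

/-- `K(M) ≅ K` maps `algebraMap k K(M) c` to `algebraMap k K c`. [folklore] -/
@[simp] theorem funFieldIso_hom_algebraMap (M : ProperModel k K) (c : k) :
    M.funFieldIso.hom.hom (algebraMap k M.X.functionField c) = algebraMap k K c := by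
  rw [← funFieldIso_inv_algebraMap, ← CommRingCat.comp_apply, Iso.inv_hom_id, CommRingCat.id_apply]

/-- **`K(M) ≅ K` as a `k`-algebra isomorphism.** [cite: ZariskiSamuel1960, Ch. VI §17] -/
def funFieldAlgEquiv (M : ProperModel k K) : M.X.functionField ≃ₐ[k] K :=
  { M.funFieldIso.commRingCatIsoToRingEquiv with
    commutes' := fun c => M.funFieldIso_hom_algebraMap c }

/-- Unfolding. [folklore] -/
@[simp] theorem funFieldAlgEquiv_apply (M : ProperModel k K) (a : M.X.functionField) :
    M.funFieldAlgEquiv a = M.funFieldIso.hom.hom a := rfl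

/-- Unfolding. [folklore] -/
@[simp] theorem funFieldAlgEquiv_symm_apply (M : ProperModel k K) (b : K) :
    M.funFieldAlgEquiv.symm b = M.funFieldIso.inv.hom b := rfl

/-- **`Spec K(M) → M → Spec k` is `Spec` of the structure map `k → K(M)`** (the hypothesis `hgen`
of `fromSpecStalk_genericPoint_toProjOfVec` for proper models). [folklore] -/
theorem fromSpecStalk_genericPoint_π (M : ProperModel k K) :
    M.X.fromSpecStalk (genericPoint M.X) ≫ M.π =
      Spec.map (CommRingCat.ofHom (algebraMap k M.X.functionField)) := by
  rw [fromSpecStalk_genericPoint_eq, Category.assoc, M.gen_π, ← Spec.map_comp,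
    algebraMap_functionField]
  rfl

/-! ## Functoriality along morphisms of models -/

/-- A morphism of proper models is dominant (its image contains the generic point).
[folklore] -/
instance Hom.isDominant {N M : ProperModel k K} (φ : N.Hom M) : IsDominant φ.f := by
  have : IsDominant (N.gen ≫ φ.f) := by rw [φ.gen_f]; infer_instance
  exact IsDominant.of_comp N.gen φ.f

/-- Local-homomorphism instances for maps out of the function field. [folklore] -/
instance isLocalHom_funFieldIso_hom (M : ProperModel k K) : IsLocalHom M.funFieldIso.hom.hom :=
  isLocalHom_of_field _

/-- **The field map of a morphism of models is compatible with the identifications with `K`**: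
for `φ : N → M`, `(φ^♯ : K(M) → K(N)) ≫ (K(N) ≅ K) = (K(M) ≅ K)` — both sides induce the
`K`-point `gen_M` (`gen_N ≫ φ = gen_M`). [cite: ZariskiSamuel1960, Ch. VI §17] -/
theorem functionFieldMap_comp_funFieldIso {N M : ProperModel k K} (φ : N.Hom M) :
    CommRingCat.ofHom (RatFn.functionFieldMap φ.f) ≫ N.funFieldIso.hom = M.funFieldIso.hom := by
  haveI : IsLocalHom (CommRingCat.ofHom (RatFn.functionFieldMap φ.f) ≫ N.funFieldIso.hom).hom :=
    isLocalHom_of_field _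
  apply hom_ext_of_specMap_comp_fromSpecStalk
  rw [Spec.map_comp, Category.assoc, specMap_functionFieldMap_fromSpecStalk,
    specMap_funFieldIso_hom_fromSpecStalk_assoc, φ.gen_f, specMap_funFieldIso_hom_fromSpecStalk]

/-- Pointwise form: `(K(N) ≅ K) (φ^♯ a) = (K(M) ≅ K) a`. [folklore] -/
@[simp] theorem funFieldIso_hom_functionFieldMap {N M : ProperModel k K} (φ : N.Hom M)
    (a : M.X.functionField) :
    N.funFieldIso.hom.hom (RatFn.functionFieldMap φ.f a) = M.funFieldIso.hom.hom a := by
  rw [← functionFieldMap_comp_funFieldIso φ]; rfl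

/-- Pointwise form with the inverses: `φ^♯ ((K ≅ K(M)) b) = (K ≅ K(N)) b`. [folklore] -/
@[simp] theorem functionFieldMap_funFieldIso_inv {N M : ProperModel k K} (φ : N.Hom M) (b : K) :
    RatFn.functionFieldMap φ.f (M.funFieldIso.inv.hom b) = N.funFieldIso.inv.hom b := by
  apply N.funFieldIso.commRingCatIsoToRingEquiv.injective
  change N.funFieldIso.hom.hom _ = N.funFieldIso.hom.hom _
  rw [funFieldIso_hom_functionFieldMap, ← CommRingCat.comp_apply, ← CommRingCat.comp_apply,
    Iso.inv_hom_id, Iso.inv_hom_id]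

/-- `φ^♯ ((K ≅ K(M)) b) = (K ≅ K(N)) b`, in terms of the `k`-algebra isomorphisms. [folklore] -/
theorem functionFieldMap_funFieldAlgEquiv_symm {N M : ProperModel k K} (φ : N.Hom M) (b : K) :
    RatFn.functionFieldMap φ.f (M.funFieldAlgEquiv.symm b) = N.funFieldAlgEquiv.symm b :=
  functionFieldMap_funFieldIso_inv φ b

/-- The field map of a morphism of models is `k`-linear. [folklore] -/
theorem functionFieldMap_algebraMap {N M : ProperModel k K} (φ : N.Hom M) (c : k) :
    RatFn.functionFieldMap φ.f (algebraMap k M.X.functionField c) =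
      algebraMap k N.X.functionField c := by
  rw [← funFieldIso_inv_algebraMap, functionFieldMap_funFieldIso_inv, funFieldIso_inv_algebraMap]

/-- **The field map `φ^♯ : K(M) → K(N)` of a morphism of models as a `k`-algebra map.**
[cite: ZariskiSamuel1960, Ch. VI §17] -/
def Hom.functionFieldAlgHom {N M : ProperModel k K} (φ : N.Hom M) :
    M.X.functionField →ₐ[k] N.X.functionField :=
  { RatFn.functionFieldMap φ.f with commutes' := functionFieldMap_algebraMap φ }

/-- Unfolding. [folklore] -/
@[simp] theorem Hom.functionFieldAlgHom_apply {N M : ProperModel k K} (φ : N.Hom M)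
    (a : M.X.functionField) : φ.functionFieldAlgHom a = RatFn.functionFieldMap φ.f a := rfl

/-- `φ^♯` is `(K ≅ K(N)) ∘ (K(M) ≅ K)`: in terms of `K` it is the identity. [folklore] -/
theorem Hom.functionFieldAlgHom_apply_eq {N M : ProperModel k K} (φ : N.Hom M)
    (a : M.X.functionField) :
    φ.functionFieldAlgHom a = N.funFieldAlgEquiv.symm (M.funFieldAlgEquiv a) := by
  change RatFn.functionFieldMap φ.f a = N.funFieldIso.inv.hom (M.funFieldIso.hom.hom a)
  rw [← functionFieldMap_funFieldIso_inv φ, ← CommRingCat.comp_apply, Iso.hom_inv_id,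
    CommRingCat.id_apply]

/-! ## The `K`-point is a monomorphism-like datum: morphisms into an isomorphism locus -/

/-- **Two morphisms into the source of `ρ : X'' → X` which agree after `ρ` and land over an open
`U ⊆ X` over which `ρ` is an isomorphism are equal** (both factor through `ρ⁻¹(U) ≅ U`).
[folklore] -/
theorem _root_.Literature.AlgebraicGeometry.Resolution.hom_ext_of_isIso_morphismRestrict
    {T X'' X : Scheme.{u}} (ρ : X'' ⟶ X) (U : X.Opens) [IsIso (ρ ∣_ U)] {a b : T ⟶ X''}
    (hab : a ≫ ρ = b ≫ ρ) (ha : Set.range (a ≫ ρ) ⊆ (U : Set X)) : a = b := by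
  -- both land in `ρ⁻¹ U`
  have hra : Set.range a ⊆ Set.range (ρ ⁻¹ᵁ U).ι := by
    rintro _ ⟨t, rfl⟩
    rw [Scheme.Opens.range_ι]
    exact ha ⟨t, rfl⟩
  have hrb : Set.range b ⊆ Set.range (ρ ⁻¹ᵁ U).ι := by
    rintro _ ⟨t, rfl⟩
    rw [Scheme.Opens.range_ι]
    show ρ (b t) ∈ U
    rw [← Scheme.Hom.comp_apply, ← hab]
    exact ha ⟨t, rfl⟩
  let a' := IsOpenImmersion.lift (ρ ⁻¹ᵁ U).ι a hra
  let b' := IsOpenImmersion.lift (ρ ⁻¹ᵁ U).ι b hrb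
  have ha' : a' ≫ (ρ ⁻¹ᵁ U).ι = a := IsOpenImmersion.lift_fac _ _ _
  have hb' : b' ≫ (ρ ⁻¹ᵁ U).ι = b := IsOpenImmersion.lift_fac _ _ _
  have key : a' ≫ (ρ ∣_ U) = b' ≫ (ρ ∣_ U) := by
    rw [← cancel_mono U.ι, Category.assoc, Category.assoc, morphismRestrict_ι,
      reassoc_of% ha', reassoc_of% hb', hab]
  rw [cancel_mono] at key
  rw [← ha', ← hb', key]

end ProperModel

end Literature.AlgebraicGeometry.Resolution

end
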